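import Mathlib
import Summits.Ventures.LatticeQCDFlow.TrivializingMaps.WitnessColumnLinkRP
import Summits.Ventures.LatticeQCDFlow.TrivializingMaps.SliceCovGramWords
import Literature.MathematicalPhysics.QuantumFieldTheory.ConstructiveQFTWave0Proofs
import HarnessLib

/-!
# THEOREM P′ — the nearest-neighbour slice covariance dominates every Gram word (strict link RP)

HONEST FRAMING: exact (Metropolis-corrected) sampling algorithms for lattice gauge theory; figures of
merit are autocorrelation/cost numbers at stated couplings and volumes; no continuum-physics claim.

Companion of `WitnessColumnRP` (THEOREM W). Notation as there: torus Wilson measure `wilsonMeasure ρ β`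
of Wave 0 (compact `G`, continuous representation `ρ`, EVEN `L`, `d ≥ 1`), a bounded measurable real
observable `X` of the spatial links of the slice `x₀ = 0`, its translates `X⁽ᵗ⁾ := timeTranslate t X`
and its column `K(t) := sliceCov ρ β X t = ⟨X X⁽ᵗ⁾⟩ - ⟨X⟩⟨X⁽ᵗ⁾⟩`; (O3) of THEORY-1 asks for `K(1) > 0`.

THE MECHANISM. Reflection positivity in the hyperplane between the slices `0 | 1` gives
`K(1) = ⟨θF̄ · F⟩_β ≥ 0` for `F = (X - ⟨X⟩)⁽¹⁾` (THEOREM W′). The tree's PROOF of that positivity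
(`Literature…ConstructiveQFTWave0Proofs`, Osterwalder–Seiler: the crossing temporal links are doubled
by Haar invariance, `LatticeRPMechanism`) says more than `≥ 0`: with `μ = Haar^E`, `g = F · e^{β A}`
(`A` = positive-half action, `WilsonRP.gObs`) and the letters `aᵢ = √(β/2) σ(ω_q)_{kl}`,
`√(β/2) conj σ(ω_q)_{kl}` (`σ` = unitarised `ρ`, `ω_q` = half plaquette = STAPLE of a crossing
plaquette `q`, `WilsonRP.coeff`),
  `Z_β · K(1) = e^{-βN·#plaq} · Σ_{n ≥ 0} (1/n!) Σ_{w ∈ Iⁿ} |∫ g · a_{w₁} ⋯ a_{wₙ} dμ|²`,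
a series of SQUARES; its finite partial sums are lower bounds (`SliceCovGramWords`, abstract). Here:
* `sliceCov_one_eq_re_osDoubled` [Wilson, `β ≥ 0`, `L` even]: the identity
  `K(1) = Z⁻¹ e^{-βN#plaq} Re D`, `D = osDoubled` the doubled Osterwalder–Seiler integral of the test
  observable `F = sliceTest ρ β X` (reflection identity `X⁽¹⁾∘Θ = X`: the tree's `timeTranslate_timeReflect`);
* **THEOREM P′** `sum_wordMoment_le_sliceCov_one`: for every finite set `s` of word lengths,
  `e^{-βN#plaq} Σ_{n ∈ s} (1/n!) Σ_{w ∈ Iⁿ} |wordMoment w|² ≤ K(1)` (also with the exact prefactor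
  `Z⁻¹ e^{-βN#plaq}`, `sum_wordMoment_le_sliceCov_one'`; one word: `wordMoment_normSq_le_sliceCov_one`).
So `K(1) = 0` forces EVERY word moment `∫ g ∏_w a dμ` to vanish — the handle by which
`WitnessNearestNeighbour` proves `K(1) > 0`.

NOT CLAIMED: `β < 0`; any evaluation of a word moment (next files); volume-uniformity of `e^{-βN#plaq}`;
odd separations `t ≥ 3`; continuum statements.

References: K. Osterwalder, E. Seiler, Ann. Phys. 110 (1978) 440, §2; E. Seiler, LNP 159 (1982)
Thm. 2.2; M. Lüscher, Commun. Math. Phys. 54 (1977) 283 (strict positivity of the transfer matrix);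
I. Montvay, G. Münster, *Quantum Fields on a Lattice* (1994) §4.2.3.
-/

noncomputable section

namespace Summit.Ventures.LatticeQCDFlow.TrivializingMaps

open MeasureTheory Finset
open scoped ComplexOrder ComplexConjugate

namespace WitnessColumn

open Literature.MathematicalPhysics.QuantumFieldTheory

/-! ## §3. The Wilson theory: `K(1)` dominates every word moment -/

section Wilson

variable {d L : ℕ} [NeZero d] [NeZero L] {G : Type*} [Group G] [TopologicalSpace G]
  [IsTopologicalGroup G] [CompactSpace G] [MeasurableSpace G] [BorelSpace G] {N : ℕ}
  (ρ : G →* Matrix (Fin N) (Fin N) ℂ)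

/-- The test observable of THEOREM P′: the centred slice-`1` copy `F = (X - ⟨X⟩_β)⁽¹⁾`,
complexified. -/
def sliceTest (β : ℝ) (X : GaugeConfig d L G → ℝ) (U : GaugeConfig d L G) : ℂ :=
  ((timeTranslate (1 : ZMod L) X U - ∫ V, X V ∂(wilsonMeasure ρ β) : ℝ) : ℂ)

/-- The **word moment** `m_w = ∫ g ∏ₜ a_{wₜ} dHaar^E` of a word `w` in the Osterwalder–Seiler letters
`aᵢ = WilsonRP.coeff` (`√(β/2)`× a unitarised-staple matrix entry or its conjugate), with
`g = F e^{β A} = WilsonRP.gObs ρ β (sliceTest ρ β X)`. -/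
def wordMoment (hρ : Continuous ρ) (β : ℝ) (X : GaugeConfig d L G → ℝ) {n : ℕ}
    (w : Fin n → WilsonRP.CoeffIndex d L N) : ℂ :=
  ∫ U, WilsonRP.gObs ρ β (sliceTest ρ β X) U * ∏ t, WilsonRP.coeff ρ hρ β (w t) U
    ∂(Measure.pi fun _ : Edge d L => haarProbability G)

/-- The **doubled Osterwalder–Seiler integral** `D = ∫∫ g(z) conj g(ΘU) exp(Σᵢ aᵢ(z) conj aᵢ(ΘU))`
of the test observable (`z = splice_C(U,Y)`; `WilsonRP.rpIntegrand₂` without its constant). -/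
def osDoubled (hρ : Continuous ρ) (β : ℝ) (X : GaugeConfig d L G → ℝ) : ℂ :=
  ∫ p, WilsonRP.gObs ρ β (sliceTest ρ β X) (LatticeRP.splice WilsonRP.crossEdges p)
      * conj (WilsonRP.gObs ρ β (sliceTest ρ β X) (GaugeConfig.timeReflect p.1))
      * Complex.exp (∑ i, WilsonRP.coeff ρ hρ β i (LatticeRP.splice WilsonRP.crossEdges p)
          * conj (WilsonRP.coeff ρ hρ β i (GaugeConfig.timeReflect p.1)))
    ∂((Measure.pi fun _ : Edge d L => haarProbability G).prod
      (Measure.pi fun _ : Edge d L => haarProbability G))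

/-- The test observable is measurable. -/
theorem measurable_sliceTest (β : ℝ) {X : GaugeConfig d L G → ℝ} (hXm : Measurable X) :
    Measurable (sliceTest ρ β X) :=
  Complex.measurable_ofReal.comp ((measurable_timeTranslate hXm _).sub measurable_const)

/-- The test observable is bounded by `C + |⟨X⟩|`. -/
theorem norm_sliceTest_le (β : ℝ) {X : GaugeConfig d L G → ℝ} {C : ℝ} (hXb : ∀ U, |X U| ≤ C)
    (U : GaugeConfig d L G) :
    ‖sliceTest ρ β X U‖ ≤ C + |∫ V, X V ∂(wilsonMeasure ρ β)| := by
  rw [sliceTest, Complex.norm_real, Real.norm_eq_abs]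
  exact (abs_sub _ _).trans (add_le_add (hXb _) le_rfl)

/-- The test observable lives on the slice `x₀ = 1 ∈ [1, L/2]`, inside the positive half `Λ₊`. -/
theorem dependsOn_sliceTest (hL : Even L) (β : ℝ) {X : GaugeConfig d L G → ℝ}
    (hX : DependsOn X (sliceEdges d L 0)) :
    DependsOn (sliceTest ρ β X) ((WilsonRP.posEdges : Finset (Edge d L)) : Set (Edge d L)) := by
  intro U V hUV
  have h2L : 2 ≤ L := by obtain ⟨r, hr⟩ := hL; have := NeZero.ne L; omega
  have key : timeTranslate (1 : ZMod L) X U = timeTranslate (1 : ZMod L) X V := by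
    refine dependsOn_timeTranslate hX 1 fun e he => hUV e ?_
    obtain ⟨he2, he0⟩ := he
    have hval : (e.1 0).val = 1 := by
      rw [he0]; exact ZMod.val_one'' (by omega)
    have hs : (e.1.shift e.2) 0 = e.1 0 := WilsonRP.shift_apply_of_ne _ he2.symm
    rw [Finset.mem_coe, WilsonRP.mem_posEdges]
    refine ⟨by omega, ?_, by rw [hs]; omega, by rw [hs]; omega⟩
    rw [hval]; exact Nat.le_div_iff_mul_le (by norm_num) |>.2 (by omega)
  show ((timeTranslate (1 : ZMod L) X U - _ : ℝ) : ℂ) = ((timeTranslate (1 : ZMod L) X V - _ : ℝ) : ℂ)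
  rw [key]

/-- **The identity `K(1) = Z⁻¹ e^{-βN#plaq} Re D`** (`β ≥ 0`, `L` even): the nearest-neighbour slice
covariance is the reflection-positive form `⟨θF̄ F⟩_β` of `F = (X - ⟨X⟩)⁽¹⁾` (`θ F = X - ⟨X⟩`,
translation invariance), and the tree's Osterwalder–Seiler doubling writes `Z ⟨θF̄ F⟩` as
`e^{-βN#plaq} D` (`WilsonRP.rpIntegrand_translate`, `measurePreserving_translate`). -/
theorem sliceCov_one_eq_re_osDoubled (hL : Even L) (hρ : Continuous ρ) {β : ℝ} (hβ : 0 ≤ β)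
    {X : GaugeConfig d L G → ℝ} (hXm : Measurable X) {C : ℝ} (hXb : ∀ U, |X U| ≤ C)
    (hX : DependsOn X (sliceEdges d L 0)) :
    sliceCov ρ β X 1 = ((partitionFunction (d := d) (L := L) ρ β)⁻¹).toReal
      * (Real.exp (-β * (N * Fintype.card (Plaquette d L))) * (osDoubled ρ hρ β X).re) := by
  haveI : Fact (1 < L) := ⟨by obtain ⟨r, hr⟩ := hL; have := NeZero.ne L; omega⟩
  haveI := isProbabilityMeasure_wilsonMeasure (d := d) (L := L) ρ hρ β
  set μ : Measure (GaugeConfig d L G) := Measure.pi fun _ : Edge d L => haarProbability G with hμ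
  set F := sliceTest ρ β X with hF_def
  set m := ∫ V, X V ∂(wilsonMeasure ρ β) with hm
  have hFm : Measurable F := measurable_sliceTest ρ β hXm
  have hFb : ∀ U, ‖F U‖ ≤ C + |m| := norm_sliceTest_le ρ β hXb
  have hFdep := dependsOn_sliceTest ρ hL β hX
  -- (1) `⟨θF̄ F⟩_β = K(1)` as a complex number
  have hlhs : ∫ U, conj (F (GaugeConfig.timeReflect U)) * F U ∂(wilsonMeasure ρ β)
      = ((sliceCov ρ β X 1 : ℝ) : ℂ) := by
    have hpt : ∀ U : GaugeConfig d L G, conj (F (GaugeConfig.timeReflect U)) * F U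
        = (((X U - m) * timeTranslate (1 : ZMod L) (fun W => X W - m) U : ℝ) : ℂ) := fun U => by
      simp only [hF_def, sliceTest, Complex.conj_ofReal, ← Complex.ofReal_mul, timeTranslate,
        Function.comp_apply]
      rw [show X (TorusTranslation.torusConfigShift (-(Pi.single 0 1 : Site d L))
          (GaugeConfig.timeReflect U)) = X U from by
        have h := timeTranslate_timeReflect hX (1 : ZMod L) U
        rwa [sub_self, timeTranslate_zero] at h]
    simp_rw [hpt]
    rw [integral_complex_ofReal, sliceCov_eq_integral_centred ρ hρ β hXm hXb]
  -- (2) `⟨θF̄ F⟩_β = Z⁻¹ ∫ rpIntegrand dμ`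
  have hdens : Measurable fun U : GaugeConfig d L G =>
      ENNReal.ofReal (Real.exp (-β * wilsonAction ρ U)) :=
    ENNReal.measurable_ofReal.comp ((WilsonRP.measurable_wilsonAction ρ hρ).const_mul (-β)).exp
  have hrhs : ∫ U, conj (F (GaugeConfig.timeReflect U)) * F U ∂(wilsonMeasure ρ β)
      = (((partitionFunction (d := d) (L := L) ρ β)⁻¹).toReal : ℂ)
        * ∫ U, WilsonRP.rpIntegrand ρ β F U ∂μ := by
    unfold wilsonMeasure
    rw [integral_smul_measure]
    unfold wilsonWeight
    rw [integral_withDensity_eq_integral_toReal_smul hdens (ae_of_all _ fun _ => ENNReal.ofReal_lt_top)]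
    simp_rw [ENNReal.toReal_ofReal (Real.exp_nonneg _), Complex.real_smul]
    rfl
  -- (3) doubling: `∫ rpIntegrand dμ = e^{-βN#plaq} D`
  have hHm : Measurable (WilsonRP.rpIntegrand ρ β F) := WilsonRP.measurable_rpIntegrand ρ hρ β hFm
  have hR : ∀ U Y, WilsonRP.rpIntegrand ρ β F (WilsonRP.translate Y U)
      = WilsonRP.rpIntegrand₂ ρ hρ β F (U, Y) :=
    fun U Y => WilsonRP.rpIntegrand_translate ρ hL hρ hβ hFdep U Y
  have hRi : Integrable (WilsonRP.rpIntegrand₂ ρ hρ β F) (μ.prod μ) :=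
    Integrable.of_bound (WilsonRP.measurable_rpIntegrand₂ ρ hρ β hFm).aestronglyMeasurable _
      (ae_of_all _ (WilsonRP.norm_rpIntegrand₂_le ρ hρ hβ hFb))
  have step1 : ∫ U, WilsonRP.rpIntegrand ρ β F U ∂μ
      = ∫ Y, ∫ U, WilsonRP.rpIntegrand₂ ρ hρ β F (U, Y) ∂μ ∂μ := by
    have hY : ∀ Y, ∫ U, WilsonRP.rpIntegrand ρ β F U ∂μ
        = ∫ U, WilsonRP.rpIntegrand₂ ρ hρ β F (U, Y) ∂μ := fun Y => by
      rw [← LatticeRP.integral_comp_eq_of_measurePreserving (WilsonRP.measurePreserving_translate Y) hHm]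
      exact integral_congr_ae (ae_of_all _ fun U => hR U Y)
    calc ∫ U, WilsonRP.rpIntegrand ρ β F U ∂μ
        = ∫ _Y, (∫ U, WilsonRP.rpIntegrand ρ β F U ∂μ) ∂μ := by
          rw [integral_const, probReal_univ, one_smul]
      _ = ∫ Y, ∫ U, WilsonRP.rpIntegrand₂ ρ hρ β F (U, Y) ∂μ ∂μ := integral_congr_ae (ae_of_all _ hY)
  have step2 : ∫ U, WilsonRP.rpIntegrand ρ β F U ∂μ
      = (Real.exp (-β * (N * Fintype.card (Plaquette d L))) : ℂ) * osDoubled ρ hρ β X := by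
    rw [step1, ← integral_prod_symm _ hRi]
    unfold WilsonRP.rpIntegrand₂ osDoubled
    rw [integral_const_mul]
  -- assemble and take real parts
  have hall : ((sliceCov ρ β X 1 : ℝ) : ℂ) = (((partitionFunction (d := d) (L := L) ρ β)⁻¹).toReal : ℂ)
      * ((Real.exp (-β * (N * Fintype.card (Plaquette d L))) : ℂ) * osDoubled ρ hρ β X) := by
    rw [← hlhs, hrhs, step2]
  have := congrArg Complex.re hall
  rw [Complex.ofReal_re] at this
  rw [this, Complex.re_ofReal_mul, Complex.re_ofReal_mul]

/-- **The word moments are dominated by `D`**: for every finite set `s` of word lengths,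
`Σ_{n ∈ s} (n!)⁻¹ Σ_{w : Fin n → I} |m_w|² ≤ Re D` (§2 with `Θ` = link reflection, `P` = positive
links, `C` = crossing links, `g = gObs`, `a = coeff`, exactly the data of the tree's
`WilsonRP.integral_rpIntegrand_nonneg`). -/
theorem sum_wordMoment_le_re_osDoubled (hL : Even L) (hρ : Continuous ρ) {β : ℝ} (hβ : 0 ≤ β)
    {X : GaugeConfig d L G → ℝ} (hXm : Measurable X) {C : ℝ} (hXb : ∀ U, |X U| ≤ C)
    (hX : DependsOn X (sliceEdges d L 0)) (s : Finset ℕ) :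
    ∑ n ∈ s, ((n.factorial : ℝ)⁻¹ *
        ∑ w : Fin n → WilsonRP.CoeffIndex d L N, ‖wordMoment ρ hρ β X w‖ ^ 2)
      ≤ (osDoubled ρ hρ β X).re := by
  haveI : Fact (1 < L) := ⟨by obtain ⟨r, hr⟩ := hL; have := NeZero.ne L; omega⟩
  have hFm : Measurable (sliceTest ρ β X) := measurable_sliceTest ρ β hXm
  have hFb : ∀ U, ‖sliceTest ρ β X U‖ ≤ C + |∫ V, X V ∂(wilsonMeasure ρ β)| :=
    norm_sliceTest_le ρ β hXb
  have hFdep := dependsOn_sliceTest ρ hL β hX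
  exact sum_words_normSq_le_re_integral (haarProbability G) WilsonRP.posEdges WilsonRP.crossEdges
    GaugeConfig.timeReflect WilsonRP.measurePreserving_timeReflect
    (fun e he => WilsonRP.dependsOn_timeReflect_apply hL e he) (WilsonRP.measurable_gObs ρ hρ β hFm)
    (fun i => WilsonRP.measurable_coeff ρ hρ β i) (WilsonRP.norm_gObs_le ρ hρ hβ hFb)
    (fun i U => WilsonRP.norm_coeff_le ρ hρ β i U) (WilsonRP.dependsOn_gObs ρ β hFdep)
    (fun i => WilsonRP.dependsOn_coeff ρ hL hρ β i) s

omit [NeZero d] in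
/-- `Z_β ≤ 1` for `β ≥ 0` (the Wilson action `Σₚ (N - Re tr ρ(U_p))` is non-negative), hence
`1 ≤ Z_β⁻¹` as a real number. -/
theorem one_le_toReal_inv_partitionFunction (hρ : Continuous ρ) {β : ℝ} (hβ : 0 ≤ β) :
    1 ≤ ((partitionFunction (d := d) (L := L) ρ β)⁻¹).toReal := by
  haveI := isProbabilityMeasure_wilsonMeasure (d := d) (L := L) ρ hρ β
  have hS : ∀ U : GaugeConfig d L G, 0 ≤ wilsonAction ρ U := fun U => by
    unfold wilsonAction
    refine Finset.sum_nonneg fun p _ => sub_nonneg.2 ?_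
    have h := WilsonRP.abs_plaqRe_le ρ hρ U p
    unfold WilsonRP.plaqRe at h
    exact (le_abs_self _).trans h
  have hZle : partitionFunction (d := d) (L := L) ρ β ≤ 1 := by
    have hZ : partitionFunction (d := d) (L := L) ρ β =
        ∫⁻ U, ENNReal.ofReal (Real.exp (-β * wilsonAction ρ U))
          ∂(Measure.pi fun _ : Edge d L => haarProbability G) := by
      simp only [partitionFunction, wilsonWeight, withDensity_apply _ MeasurableSet.univ,
        Measure.restrict_univ]
    rw [hZ]
    calc ∫⁻ U, ENNReal.ofReal (Real.exp (-β * wilsonAction ρ U))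
          ∂(Measure.pi fun _ : Edge d L => haarProbability G)
        ≤ ∫⁻ _U, 1 ∂(Measure.pi fun _ : Edge d L => haarProbability G) :=
          lintegral_mono fun U => by
            rw [← ENNReal.ofReal_one]
            refine ENNReal.ofReal_le_ofReal (Real.exp_le_one_iff.2 ?_)
            have := mul_nonneg hβ (hS U)
            linarith
      _ = 1 := by rw [lintegral_const, measure_univ, mul_one]
  have h0 : partitionFunction (d := d) (L := L) ρ β ≠ 0 := by
    intro h
    have h1 := (isProbabilityMeasure_wilsonMeasure (d := d) (L := L) ρ hρ β).measure_univ
    have h2 : (wilsonMeasure ρ β) (Set.univ : Set (GaugeConfig d L G))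
        = (partitionFunction (d := d) (L := L) ρ β)⁻¹ * partitionFunction (d := d) (L := L) ρ β := by
      simp only [wilsonMeasure, Measure.smul_apply, smul_eq_mul, partitionFunction]
    rw [h2, h, mul_zero] at h1
    exact zero_ne_one h1
  have hinv : (1 : ENNReal) ≤ (partitionFunction (d := d) (L := L) ρ β)⁻¹ :=
    ENNReal.one_le_inv.2 hZle
  have hne : (partitionFunction (d := d) (L := L) ρ β)⁻¹ ≠ ⊤ := ENNReal.inv_ne_top.2 h0
  calc (1 : ℝ) = (1 : ENNReal).toReal := by simp
    _ ≤ _ := (ENNReal.toReal_le_toReal ENNReal.one_ne_top hne).2 hinv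

/-- **THEOREM P′ (exact prefactor).** For `β ≥ 0`, `L` even, a bounded measurable slice-`0`
observable `X` and every finite set `s` of word lengths:
`Z_β⁻¹ e^{-βN#plaq} Σ_{n ∈ s} (n!)⁻¹ Σ_{w : Fin n → I} |m_w|² ≤ K(1) = sliceCov ρ β X 1`. -/
theorem sum_wordMoment_le_sliceCov_one' (hL : Even L) (hρ : Continuous ρ) {β : ℝ} (hβ : 0 ≤ β)
    {X : GaugeConfig d L G → ℝ} (hXm : Measurable X) {C : ℝ} (hXb : ∀ U, |X U| ≤ C)
    (hX : DependsOn X (sliceEdges d L 0)) (s : Finset ℕ) :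
    ((partitionFunction (d := d) (L := L) ρ β)⁻¹).toReal
        * (Real.exp (-β * (N * Fintype.card (Plaquette d L)))
          * ∑ n ∈ s, ((n.factorial : ℝ)⁻¹ *
              ∑ w : Fin n → WilsonRP.CoeffIndex d L N, ‖wordMoment ρ hρ β X w‖ ^ 2))
      ≤ sliceCov ρ β X 1 := by
  rw [sliceCov_one_eq_re_osDoubled ρ hL hρ hβ hXm hXb hX]
  exact mul_le_mul_of_nonneg_left (mul_le_mul_of_nonneg_left
    (sum_wordMoment_le_re_osDoubled ρ hL hρ hβ hXm hXb hX s) (Real.exp_pos _).le) ENNReal.toReal_nonneg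

/-- **THEOREM P′ — the nearest-neighbour slice covariance dominates every Gram word.** For `β ≥ 0`,
`L` even, a bounded measurable slice-`0` observable `X` and every finite set `s` of word lengths:
`e^{-βN#plaq} Σ_{n ∈ s} (n!)⁻¹ Σ_{w : Fin n → I} |∫ g ∏ₜ a_{wₜ} dHaar^E|² ≤ K(1)`.
In particular `K(1) = 0` forces every word moment to vanish. -/
theorem sum_wordMoment_le_sliceCov_one (hL : Even L) (hρ : Continuous ρ) {β : ℝ} (hβ : 0 ≤ β)
    {X : GaugeConfig d L G → ℝ} (hXm : Measurable X) {C : ℝ} (hXb : ∀ U, |X U| ≤ C)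
    (hX : DependsOn X (sliceEdges d L 0)) (s : Finset ℕ) :
    Real.exp (-β * (N * Fintype.card (Plaquette d L)))
        * ∑ n ∈ s, ((n.factorial : ℝ)⁻¹ *
            ∑ w : Fin n → WilsonRP.CoeffIndex d L N, ‖wordMoment ρ hρ β X w‖ ^ 2)
      ≤ sliceCov ρ β X 1 := by
  have h := sum_wordMoment_le_sliceCov_one' ρ hL hρ hβ hXm hXb hX s
  have hnn : 0 ≤ Real.exp (-β * (N * Fintype.card (Plaquette d L)))
      * ∑ n ∈ s, ((n.factorial : ℝ)⁻¹ *
          ∑ w : Fin n → WilsonRP.CoeffIndex d L N, ‖wordMoment ρ hρ β X w‖ ^ 2) :=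
    mul_nonneg (Real.exp_pos _).le (Finset.sum_nonneg fun n _ => mul_nonneg
      (inv_nonneg.2 (Nat.cast_nonneg _)) (Finset.sum_nonneg fun w _ => sq_nonneg _))
  calc _ = 1 * _ := (one_mul _).symm
    _ ≤ _ := mul_le_mul_of_nonneg_right (one_le_toReal_inv_partitionFunction ρ hρ hβ) hnn
    _ ≤ _ := h

/-- **Corollary (single word).** Every single word moment is dominated:
`e^{-βN#plaq} (n!)⁻¹ |m_w|² ≤ K(1)` for every word `w` of length `n`. -/
theorem wordMoment_normSq_le_sliceCov_one (hL : Even L) (hρ : Continuous ρ) {β : ℝ} (hβ : 0 ≤ β)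
    {X : GaugeConfig d L G → ℝ} (hXm : Measurable X) {C : ℝ} (hXb : ∀ U, |X U| ≤ C)
    (hX : DependsOn X (sliceEdges d L 0)) {n : ℕ} (w : Fin n → WilsonRP.CoeffIndex d L N) :
    Real.exp (-β * (N * Fintype.card (Plaquette d L))) * ((n.factorial : ℝ)⁻¹ * ‖wordMoment ρ hρ β X w‖ ^ 2)
      ≤ sliceCov ρ β X 1 := by
  refine le_trans (mul_le_mul_of_nonneg_left ?_ (Real.exp_pos _).le)
    (sum_wordMoment_le_sliceCov_one ρ hL hρ hβ hXm hXb hX {n})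
  rw [Finset.sum_singleton]
  exact mul_le_mul_of_nonneg_left (Finset.single_le_sum (f := fun w => ‖wordMoment ρ hρ β X w‖ ^ 2)
    (fun w _ => sq_nonneg _) (Finset.mem_univ w)) (inv_nonneg.2 (Nat.cast_nonneg _))

end Wilson

end WitnessColumn

end Summit.Ventures.LatticeQCDFlow.TrivializingMaps

end
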